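import Literature.NumberTheory.Automorphic.Liu2021.AppendixC.HeckeImage
import Literature.NumberTheory.Automorphic.Liu2021.AppendixC.OmegaHomHeckeOperator
import Literature.NumberTheory.Automorphic.Liu2021.AppendixC.EtaleFaltingsTower
import Literature.NumberTheory.Automorphic.HeckeFixedVectorsSimple
import Literature.RingTheory.SimpleModule.StableSubspacesSemilinearTransport
import Literature.RingTheory.Idempotents.CentralIdempotentSimpleSubmodule
import Literature.LinearAlgebra.BaseChange.FixedPointsBaseChange
import HarnessLib

/-!
# [Liu 2021, p. 133 (D.3) / p. 140] THE block of an irreducible constituent: exactly one block of the image of the Hecke algebra acts as `1` on `ι_ℓ ∘ ω` (d6 S2′ row 7)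

Topic `NumberTheory/Automorphic/Liu2021/AppendixC`; namespace `Literature.NumberTheory.Automorphic.Liu2021.AppendixC.Sec42Data.HeckeTranslates`.
THEOREMS ONLY (no definition, no named fact, no instance, no `sorry`).  Print, [Liu2021] p. 133 (D.3): `H¹_B(A_K^st, ℂ) ≃ ⊕_{π^∞} H¹_B(Sh(G,h)_K,
ℂ)[(π^∞)^K]` «of `C_c^∞(K\G(𝔸^∞)/K, ℚ)`-modules», and p. 140: «Using Hecke operators, we may find a surjective homomorphism `ϕ : A_K → B` … such that
`ϕ^* : H¹_B(B, ℚ) → H¹_B(A_K, ℚ)[π^∞]` is an isomorphism.»  The block `[π^∞]` is cut by a central idempotent of the image of the Hecke algebra in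
`End(A_K)_ℚ` (★ `heckeImage`); this file SELECTS it from an IRREDUCIBLE constituent `(W, ω)` and a non-zero `f′ ∈ Hom_𝔾(ι_ℓ ∘ ω, ℚ̄_ℓ ⊗ H¹_ét(A_∞))`
(★ `X.omegaHom ι ρW`): among a complete family of orthogonal central idempotents of `heckeImage K` EXACTLY ONE acts as the identity on the level-`K`
classes under `f′(ω^K)` — `ω^K` is a simple module over the Hecke operators ([Bump1997] Prop. 4.2.3, ★ `HeckeFixedVectorsSimple`), `f′` intertwines
them with `[KgK]` on the tower (★ `OmegaHomHeckeOperator`), which at level `K` are the realisations of the Hecke endomorphisms (★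
`toTower_baseChange_dualMap_rationalTateAction_heckeEnd`), and a central idempotent acts on a simple module by `1` or `0` (★ `CentralIdempotentSimpleSubmodule`).

* §1 bookkeeping for the base-changed realisation `x ↦ ᵗV_ℓ^ℚ x ⊗ 1` (`_mul`, `_add`, `_one`, `_zero`, `_sum`, `_mem_adjoin`).
* §2 `baseChange_dualMap_rationalTateAction_heckeEnd_mem_comap_map` (the subspace `[·]_K⁻¹ (f′(ω^K))` of `ℚ̄_ℓ ⊗ H¹_ét(A_K)` is Hecke-stable),
  `eq_bot_or_coe_eq_of_forall_heckeEnd_stable` (for irreducible `ω` it has no non-zero proper Hecke-stable subspace; ★ `StableSubspacesSemilinearTransport`).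
* §3 `existsUnique_block_baseChange_toTower_eq` — the selector, instance-free: `∃! i, ∀ w ∈ ω^K, ∀ x, [x]_K = f′ w → [ᵗV_ℓ^ℚ(c_i) x]_K = f′ w`
  (`[·]_K = (toTower K) ⊗ ℚ̄_ℓ`); hypotheses `X.rhoEt = T.etHeckeRep ℓ` (`rfl` for the tree's `etaleHeckeDatumOfTranslates`), injective pull-backs `hI`,
  `f′ ≠ 0` on `ω^K`, and `hfK` (values are level-`K` classes) — discharged in §4 `apply_mem_range_toTower_baseChange` ((R ⊗ tower)^K = R ⊗ tower^K,
  ★ `FixedPointsBaseChange`), whence the final form `existsUnique_block_baseChange_toTower_eq'`.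

DICTIONARY LINE (cell `hodgecm-mathlib`, crux `HLiu418` = stmt-HodgeConjecture-24832, d6 HOME card S2′ row 7 «`χ|_Z = lab`»): `ε_lab := c i₀` for the unique
`i₀`; then ★ DH2c-core `exists_hom_of_isIdempotentElem_of_mem_center_heckeImage` gives the honest projector `u` of row 3.  The file moves no book
(HC_CM is proved only modulo the 7 printed citations until rung 0 closes).

## References
* [Liu2021] Y. Liu, *Fourier–Jacobi cycles and arithmetic relative trace formula*, Camb. J. Math. 9 (2021): p. 133 (D.3) (FJcycle.tex l. 5463–5470), p. 140
  (l. 5626), §4.2 (l. 2158–2166), Thm. 4.18 (1) (l. 2239).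
* [Bump1997] D. Bump, *Automorphic Forms and Representations* (1997), §4.2 Prop. 4.2.3.
* [Lam2001FirstCourse] T. Y. Lam, *A First Course in Noncommutative Rings*, §22 Prop. (22.1), p. 327.
* [MumfordAV1970] D. Mumford, *Abelian Varieties*, §19 Thm. 3.  * [Milne2017] J. S. Milne, *Algebraic Groups* (CUP 2017), Cor. 4.34.
-/

set_option autoImplicit false

noncomputable section

open CategoryTheory NumberField Function MulAction
open scoped TensorProduct

namespace Literature.NumberTheory.Automorphic.Liu2021.AppendixC

open Literature.AlgebraicGeometry.Motives (AbelianVariety)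
open Literature.AlgebraicGeometry.Motives.AbelianVariety (rationalTateModuleMap endAlgebra rationalTateAction rationalTateAction_algebraMap)

variable {F E : Type} [Field F] [NumberField F] [IsTotallyReal F] [Field E] [NumberField E] [Algebra F E]
  [IsTotallyComplex E] [Algebra.IsQuadraticExtension F E]
variable {P5 : PropC5Data F E} {isotropicAt : ℕ → Prop}

namespace Sec42Data.HeckeTranslates

variable {C : Sec42Data P5 isotropicAt} (T : C.HeckeTranslates) (ℓ : ℕ) [Fact ℓ.Prime]

/-! ## §1 The base-changed realisation `x ↦ ᵗ(V_ℓ^ℚ x) ⊗ ℚ̄_ℓ` of `End⁰(A_K)` on `ℚ̄_ℓ ⊗ H¹_ét(A_K)` (bookkeeping) -/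

section Op

variable (K : C5.SmallLevel C.S.K₀)

/-- `ᵗV_ℓ^ℚ(x y) ⊗ 1 = (ᵗV_ℓ^ℚ y ⊗ 1) ∘ (ᵗV_ℓ^ℚ x ⊗ 1)` (contravariance of `H¹`). [cite: MumfordAV1970, §19 Thm. 3] -/
theorem baseChange_dualMap_rationalTateAction_mul (x y : (C.A K).endAlgebra) :
    ((rationalTateAction (C.A K) ℓ (x * y)).dualMap).baseChange (AlgebraicClosure ℚ_[ℓ]) =
      ((rationalTateAction (C.A K) ℓ y).dualMap).baseChange (AlgebraicClosure ℚ_[ℓ]) ∘ₗ ((rationalTateAction (C.A K) ℓ x).dualMap).baseChange (AlgebraicClosure ℚ_[ℓ]) := by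
  rw [map_mul, Module.End.mul_eq_comp, ← LinearMap.dualMap_comp_dualMap, LinearMap.baseChange_comp]

/-- `ᵗV_ℓ^ℚ(x + y) ⊗ 1 = ᵗV_ℓ^ℚ x ⊗ 1 + ᵗV_ℓ^ℚ y ⊗ 1`. [cite: MumfordAV1970, §19 Thm. 3] -/
theorem baseChange_dualMap_rationalTateAction_add (x y : (C.A K).endAlgebra) :
    ((rationalTateAction (C.A K) ℓ (x + y)).dualMap).baseChange (AlgebraicClosure ℚ_[ℓ]) =
      ((rationalTateAction (C.A K) ℓ x).dualMap).baseChange (AlgebraicClosure ℚ_[ℓ]) + ((rationalTateAction (C.A K) ℓ y).dualMap).baseChange (AlgebraicClosure ℚ_[ℓ]) := by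
  rw [map_add, ← LinearMap.baseChange_add]
  congr 1; ext φ v; simp [LinearMap.dualMap_apply]

/-- `ᵗV_ℓ^ℚ(1) ⊗ 1 = 1`. [cite: MumfordAV1970, §19 Thm. 3] -/
theorem baseChange_dualMap_rationalTateAction_one :
    ((rationalTateAction (C.A K) ℓ (1 : (C.A K).endAlgebra)).dualMap).baseChange (AlgebraicClosure ℚ_[ℓ]) = LinearMap.id := by
  rw [map_one, show ((1 : Module.End ℚ_[ℓ] ((C.A K).rationalTateModule ℓ))).dualMap = LinearMap.id from LinearMap.dualMap_id]
  exact LinearMap.baseChange_id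

/-- `ᵗV_ℓ^ℚ(0) ⊗ 1 = 0`. [cite: MumfordAV1970, §19 Thm. 3] -/
theorem baseChange_dualMap_rationalTateAction_zero :
    ((rationalTateAction (C.A K) ℓ (0 : (C.A K).endAlgebra)).dualMap).baseChange (AlgebraicClosure ℚ_[ℓ]) = 0 := by
  have h1 : ((0 : Module.End ℚ_[ℓ] ((C.A K).rationalTateModule ℓ))).dualMap = 0 := by ext φ v; simp [LinearMap.dualMap_apply]
  rw [map_zero, h1, LinearMap.baseChange_zero]

/-- … hence over finite sums. [cite: MumfordAV1970, §19 Thm. 3] -/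
theorem baseChange_dualMap_rationalTateAction_sum {I : Type*} (s : Finset I) (c : I → (C.A K).endAlgebra) :
    ((rationalTateAction (C.A K) ℓ (∑ i ∈ s, c i)).dualMap).baseChange (AlgebraicClosure ℚ_[ℓ]) =
      ∑ i ∈ s, ((rationalTateAction (C.A K) ℓ (c i)).dualMap).baseChange (AlgebraicClosure ℚ_[ℓ]) := by
  classical
  induction s using Finset.induction_on with
  | empty => rw [Finset.sum_empty, Finset.sum_empty, baseChange_dualMap_rationalTateAction_zero]
  | insert a s ha ih => rw [Finset.sum_insert ha, Finset.sum_insert ha, baseChange_dualMap_rationalTateAction_add, ih]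

/-- The realisation of `heckeImage K` lies in the `ℚ̄_ℓ`-algebra generated by the realised Hecke endomorphisms (anti-multiplicativity is harmless:
subalgebras are closed under products in either order). [cite: Liu2021, p. 133 (before (D.3))] -/
theorem baseChange_dualMap_rationalTateAction_mem_adjoin (hD : T.IsogenyDescent) {x : (C.A K).endAlgebra} (hx : x ∈ T.heckeImage hD K) :
    ((rationalTateAction (C.A K) ℓ x).dualMap).baseChange (AlgebraicClosure ℚ_[ℓ]) ∈
      Algebra.adjoin (AlgebraicClosure ℚ_[ℓ]) (Set.range fun g : C.G => ((rationalTateAction (C.A K) ℓ (T.heckeEnd hD K g)).dualMap).baseChange (AlgebraicClosure ℚ_[ℓ])) := by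
  induction hx using Algebra.adjoin_induction with
  | mem y hy =>
    obtain ⟨g, rfl⟩ := hy
    exact Algebra.subset_adjoin ⟨g, rfl⟩
  | algebraMap q =>
    have h1 : (rationalTateAction (C.A K) ℓ (algebraMap ℚ (C.A K).endAlgebra q)).dualMap =
        (algebraMap ℚ ℚ_[ℓ] q) • (LinearMap.id : C.etaleH1 ℓ K →ₗ[ℚ_[ℓ]] C.etaleH1 ℓ K) := by
      rw [rationalTateAction_algebraMap]
      ext φ v
      simp [LinearMap.dualMap_apply, Algebra.algebraMap_eq_smul_one]
    rw [h1, LinearMap.baseChange_smul, LinearMap.baseChange_id, ← algebraMap_smul (AlgebraicClosure ℚ_[ℓ]) (algebraMap ℚ ℚ_[ℓ] q),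
      ← Module.End.one_eq_id, ← Algebra.algebraMap_eq_smul_one]
    exact Subalgebra.algebraMap_mem _ _
  | add y z _ _ hy hz => rw [baseChange_dualMap_rationalTateAction_add]; exact add_mem hy hz
  | mul y z _ _ hy hz => rw [baseChange_dualMap_rationalTateAction_mul]; exact mul_mem hz hy

end Op

/-! ## §2 The level-`K` classes under `f′(ω^K)`: a subspace with no non-zero proper Hecke-stable subspace -/

section Selector

variable {ℓ}
variable (K : C5.SmallLevel C.S.K₀)
  (hI : ∀ ⦃K K' : C5.SmallLevel C.S.K₀⦄ (f : K' ⟶ K), Function.Injective (rationalTateModuleMap ℓ (C.Atr f)).dualMap)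
  (X : C.EtaleHeckeDatum ℓ) (hX : X.rhoEt = T.etHeckeRep ℓ) (ι : ℂ ≃+* AlgebraicClosure ℚ_[ℓ])
  {W : Type} [AddCommGroup W] [Module ℂ W] (ρW : Representation ℂ C.G W)
  {f : W →ₛₗ[(ι : ℂ →+* AlgebraicClosure ℚ_[ℓ])] AlgebraicClosure ℚ_[ℓ] ⊗[ℚ_[ℓ]] C.etaleH1Tower ℓ} (hf : f ∈ X.omegaHom ι ρW)

include hX hf in
/-- **Hecke stability of the level-`K` classes under `f′(ω^K)`**: the `ℚ̄_ℓ`-subspace `[·]_K⁻¹ (f′(ω^K))` of `ℚ̄_ℓ ⊗ H¹_ét(A_K)` is stable under the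
realised Hecke endomorphisms `ᵗV_ℓ^ℚ [KgK] ⊗ 1` (they act as `[KgK]` through `[·]_K`, ★ `toTower_baseChange_dualMap_rationalTateAction_heckeEnd`; `f′`
intertwines `[KgK]_ω` with `[KgK] ⊗ 1`, ★ `OmegaHomHeckeOperator`; and `[KgK]_ω` preserves `ω^K`).
[cite: Liu2021, §4.2 (FJcycle.tex l. 2160–2166)] [cite: Bump1997, §4.2 Prop. 4.2.3] -/
theorem baseChange_dualMap_rationalTateAction_heckeEnd_mem_comap_map (hD : T.IsogenyDescent) (g : C.G) {x : ((AlgebraicClosure ℚ_[ℓ]) ⊗[ℚ_[ℓ]] C.etaleH1 ℓ K)}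
    (hx : x ∈ ((ρW.fixedPoints (K.1.1 : Subgroup C.G)).map f).comap ((C.toTower ℓ K).baseChange (AlgebraicClosure ℚ_[ℓ]))) :
    ((rationalTateAction (C.A K) ℓ (T.heckeEnd hD K g)).dualMap).baseChange (AlgebraicClosure ℚ_[ℓ]) x ∈
      ((ρW.fixedPoints (K.1.1 : Subgroup C.G)).map f).comap ((C.toTower ℓ K).baseChange (AlgebraicClosure ℚ_[ℓ])) := by
  have hfin : (orbit (K.1.1 : Subgroup C.G) (g : C.G ⧸ (K.1.1 : Subgroup C.G))).Finite := Sec42Data.BettiPinning.finite_orbit_level K g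
  rw [Submodule.mem_comap] at hx ⊢
  obtain ⟨w, hw, hwx⟩ := Submodule.mem_map.1 hx
  rw [T.toTower_baseChange_dualMap_rationalTateAction_heckeEnd ℓ hD K g (AlgebraicClosure ℚ_[ℓ]) x, ← hwx, ← hX,
    ← Sec42Data.EtaleHeckeDatum.apply_heckeOperator_eq_baseChange_heckeOperator_apply X ι ρW hf _ g hfin hw]
  exact Submodule.mem_map.2 ⟨_, Literature.NumberTheory.Automorphic.heckeOperator_apply_mem_fixedPoints ρW _ g hw hfin, rfl⟩

include hI hX hf in
/-- **No non-zero proper Hecke-stable subspace** inside `[·]_K⁻¹ (f′(ω^K))` when `ω` is IRREDUCIBLE: `ω^K` is a simple module over the Hecke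
operators ([Bump1997] Prop. 4.2.3, ★ `HeckeFixedVectorsSimple`), the property transports along the semilinear intertwiner `f′` (★
`StableSubspacesSemilinearTransport`) and pulls back along the injective `[·]_K ⊗ ℚ̄_ℓ`.
[cite: Bump1997, §4.2 Prop. 4.2.3] [cite: Liu2021, §4.2 (FJcycle.tex l. 2160–2166) and p. 133 (D.3)] -/
theorem eq_bot_or_coe_eq_of_forall_heckeEnd_stable (hD : T.IsogenyDescent) [ρW.IsIrreducible] (U : Submodule (AlgebraicClosure ℚ_[ℓ]) ((AlgebraicClosure ℚ_[ℓ]) ⊗[ℚ_[ℓ]] C.etaleH1 ℓ K))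
    (hU : (U : Set ((AlgebraicClosure ℚ_[ℓ]) ⊗[ℚ_[ℓ]] C.etaleH1 ℓ K)) ⊆ ((ρW.fixedPoints (K.1.1 : Subgroup C.G)).map f).comap ((C.toTower ℓ K).baseChange (AlgebraicClosure ℚ_[ℓ])))
    (hUS : ∀ s ∈ Set.range (fun g : C.G => ((rationalTateAction (C.A K) ℓ (T.heckeEnd hD K g)).dualMap).baseChange (AlgebraicClosure ℚ_[ℓ])), ∀ u ∈ U, s u ∈ U) :
    U = ⊥ ∨ (U : Set ((AlgebraicClosure ℚ_[ℓ]) ⊗[ℚ_[ℓ]] C.etaleH1 ℓ K)) = ((ρW.fixedPoints (K.1.1 : Subgroup C.G)).map f).comap ((C.toTower ℓ K).baseChange (AlgebraicClosure ℚ_[ℓ])) := by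
  classical
  obtain ⟨j, hj⟩ : ∃ j : ((AlgebraicClosure ℚ_[ℓ]) ⊗[ℚ_[ℓ]] C.etaleH1 ℓ K) →ₗ[(AlgebraicClosure ℚ_[ℓ])] (AlgebraicClosure ℚ_[ℓ]) ⊗[ℚ_[ℓ]] C.etaleH1Tower ℓ, j = (C.toTower ℓ K).baseChange (AlgebraicClosure ℚ_[ℓ]) := ⟨_, rfl⟩
  have hjinj : Function.Injective j := by
    rw [hj]
    exact toTower_baseChange_injective C ℓ (C.toTower_injective ℓ hI K)
  set Wfix : Submodule ℂ W := ρW.fixedPoints (K.1.1 : Subgroup C.G) with hWfix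
  rw [← hj] at hU ⊢
  have hfin : ∀ g : C.G, (orbit (K.1.1 : Subgroup C.G) (g : C.G ⧸ (K.1.1 : Subgroup C.G))).Finite :=
    fun g => Sec42Data.BettiPinning.finite_orbit_level K g
  have hP3 : ∀ (g : C.G) (x : ((AlgebraicClosure ℚ_[ℓ]) ⊗[ℚ_[ℓ]] C.etaleH1 ℓ K)), j (((rationalTateAction (C.A K) ℓ (T.heckeEnd hD K g)).dualMap).baseChange (AlgebraicClosure ℚ_[ℓ]) x) =
      (Literature.NumberTheory.Automorphic.heckeOperator X.rhoEt (K.1.1 : Subgroup C.G) g).baseChange (AlgebraicClosure ℚ_[ℓ]) (j x) := by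
    intro g x
    rw [hX, hj]
    exact T.toTower_baseChange_dualMap_rationalTateAction_heckeEnd ℓ hD K g (AlgebraicClosure ℚ_[ℓ]) x
  have hWS : ∀ (g : C.G), ∀ w ∈ Wfix, Literature.NumberTheory.Automorphic.heckeOperator ρW (K.1.1 : Subgroup C.G) g w ∈ Wfix :=
    fun g w hw => Literature.NumberTheory.Automorphic.heckeOperator_apply_mem_fixedPoints ρW _ g hw (hfin g)
  have hpartner : ∀ (g : C.G), ∀ w ∈ Wfix, f (Literature.NumberTheory.Automorphic.heckeOperator ρW (K.1.1 : Subgroup C.G) g w) =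
      (Literature.NumberTheory.Automorphic.heckeOperator X.rhoEt (K.1.1 : Subgroup C.G) g).baseChange (AlgebraicClosure ℚ_[ℓ]) (f w) :=
    fun g w hw => Sec42Data.EtaleHeckeDatum.apply_heckeOperator_eq_baseChange_heckeOperator_apply X ι ρW hf _ g (hfin g) hw
  have hWsimple : ∀ U₀ : Submodule ℂ W, U₀ ≤ Wfix →
      (∀ s ∈ Set.range (fun g : C.G => Literature.NumberTheory.Automorphic.heckeOperator ρW (K.1.1 : Subgroup C.G) g), ∀ u ∈ U₀, s u ∈ U₀) →
      U₀ = ⊥ ∨ U₀ = Wfix := by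
    intro U₀ hU₀ hU₀S
    by_cases hU0 : U₀ = ⊥
    · exact Or.inl hU0
    · refine Or.inr (Literature.NumberTheory.Automorphic.eq_fixedPoints_of_heckeOperator_stable ρW _ hfin hU₀ hU0 fun g u hu => ?_)
      exact hU₀S _ ⟨g, rfl⟩ u hu
  -- push `U` forward along `j`
  have hU'le : U.map j ≤ Wfix.map f := by
    rintro _ ⟨u, hu, rfl⟩
    exact Submodule.mem_comap.1 (hU hu)
  have hU'S : ∀ s' ∈ Set.range (fun g : C.G =>
      (Literature.NumberTheory.Automorphic.heckeOperator X.rhoEt (K.1.1 : Subgroup C.G) g).baseChange (AlgebraicClosure ℚ_[ℓ])),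
      ∀ u ∈ U.map j, s' u ∈ U.map j := by
    rintro _ ⟨g, rfl⟩ _ ⟨u, hu, rfl⟩
    exact ⟨_, hUS _ ⟨g, rfl⟩ u hu, hP3 g u⟩
  have key := Literature.RingTheory.SimpleModule.eq_bot_or_eq_map_of_forall_stable f Wfix
    (S := Set.range (fun g : C.G => Literature.NumberTheory.Automorphic.heckeOperator ρW (K.1.1 : Subgroup C.G) g))
    (S' := Set.range (fun g : C.G =>
      (Literature.NumberTheory.Automorphic.heckeOperator X.rhoEt (K.1.1 : Subgroup C.G) g).baseChange (AlgebraicClosure ℚ_[ℓ])))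
    (by rintro _ ⟨g, rfl⟩ w hw; exact hWS g w hw) hWsimple
    (by rintro _ ⟨g, rfl⟩; exact ⟨_, ⟨g, rfl⟩, fun w hw => hpartner g w hw⟩) (U.map j) hU'le hU'S
  rcases key with h | h
  · left
    refine (Submodule.eq_bot_iff _).2 fun u hu => hjinj ?_
    have : j u ∈ U.map j := Submodule.mem_map.2 ⟨u, hu, rfl⟩
    rw [h, Submodule.mem_bot] at this
    rw [this, map_zero]
  · right
    refine Set.Subset.antisymm hU fun n hn => ?_
    have hn' : j n ∈ Wfix.map f := Submodule.mem_comap.1 hn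
    rw [← h] at hn'
    obtain ⟨u, hu, hju⟩ := Submodule.mem_map.1 hn'
    rw [← hjinj hju]
    exact hu

/-! ## §3 The selector -/

set_option maxHeartbeats 400000 in
include hI hX hf in
/-- **THE BLOCK OF AN IRREDUCIBLE CONSTITUENT.**  Let `(W, ω)` be irreducible, `f′ ∈ Hom_𝔾(ι_ℓ ∘ ω, ℚ̄_ℓ ⊗ H¹_ét(A_∞))` non-zero on `ω^K` with values
in the level-`K` classes, and `c_i` a complete family of orthogonal central idempotents of the image of the Hecke algebra `heckeImage K ≤ End⁰(A_K)`
(its blocks).  Then EXACTLY ONE `c_i` acts as the identity on the level-`K` classes under `f′(ω^K)`: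
`∃! i, ∀ w ∈ ω^K, ∀ x, [x]_K = f′ w → [ᵗV_ℓ^ℚ(c_i) x]_K = f′ w` — the block `H¹[(π^∞)^K]` of the constituent.
[cite: Liu2021, p. 133 (D.3) and p. 140 (proof of Thm. D.6 (1), FJcycle.tex l. 5626)] [cite: Bump1997, §4.2 Prop. 4.2.3] [cite: Lam2001FirstCourse, §22 Prop. (22.1), p. 327] -/
theorem existsUnique_block_baseChange_toTower_eq (hD : T.IsogenyDescent) [ρW.IsIrreducible]
    (hfK : ∀ w ∈ ρW.fixedPoints (K.1.1 : Subgroup C.G), f w ∈ LinearMap.range ((C.toTower ℓ K).baseChange (AlgebraicClosure ℚ_[ℓ])))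
    (hf0 : ∃ w ∈ ρW.fixedPoints (K.1.1 : Subgroup C.G), f w ≠ 0)
    {I : Type*} [Fintype I] {c : I → (C.A K).endAlgebra} (hcT : ∀ i, c i ∈ T.heckeImage hD K) (hco : CompleteOrthogonalIdempotents c)
    (hz : ∀ i, ∀ x ∈ T.heckeImage hD K, x * c i = c i * x) :
    ∃! i, ∀ w ∈ ρW.fixedPoints (K.1.1 : Subgroup C.G), ∀ x : ((AlgebraicClosure ℚ_[ℓ]) ⊗[ℚ_[ℓ]] C.etaleH1 ℓ K),
      (C.toTower ℓ K).baseChange (AlgebraicClosure ℚ_[ℓ]) x = f w →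
        (C.toTower ℓ K).baseChange (AlgebraicClosure ℚ_[ℓ]) (((rationalTateAction (C.A K) ℓ (c i)).dualMap).baseChange (AlgebraicClosure ℚ_[ℓ]) x) = f w := by
  classical
  -- OPAQUE abbreviations (`obtain … := ⟨_, rfl⟩`; no `let`-values inside types): `op x = ᵗV_ℓ^ℚ x ⊗ 1`, `Sgen = {op [KgK]}`, `N₀ = [·]_K⁻¹ (f(ω^K))`
  obtain ⟨op, hop⟩ : ∃ op : (C.A K).endAlgebra → Module.End (AlgebraicClosure ℚ_[ℓ]) ((AlgebraicClosure ℚ_[ℓ]) ⊗[ℚ_[ℓ]] C.etaleH1 ℓ K),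
      op = fun x => ((rationalTateAction (C.A K) ℓ x).dualMap).baseChange (AlgebraicClosure ℚ_[ℓ]) := ⟨_, rfl⟩
  have hop' : ∀ x, op x = ((rationalTateAction (C.A K) ℓ x).dualMap).baseChange (AlgebraicClosure ℚ_[ℓ]) := fun x => by rw [hop]
  have op_mul : ∀ x y, op (x * y) = op y * op x := fun x y => by
    rw [hop', hop', hop', Module.End.mul_eq_comp]
    exact baseChange_dualMap_rationalTateAction_mul ℓ K x y
  have op_sum : ∀ (s : Finset I), op (∑ i ∈ s, c i) = ∑ i ∈ s, op (c i) := fun s => by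
    rw [hop', baseChange_dualMap_rationalTateAction_sum ℓ K]
    exact Finset.sum_congr rfl fun i _ => (hop' (c i)).symm
  have op_one : op 1 = 1 := by rw [hop', baseChange_dualMap_rationalTateAction_one ℓ K, Module.End.one_eq_id]
  have op_zero : op 0 = 0 := by rw [hop', baseChange_dualMap_rationalTateAction_zero ℓ K]
  obtain ⟨Sgen, hSgen⟩ : ∃ S : Set (Module.End (AlgebraicClosure ℚ_[ℓ]) ((AlgebraicClosure ℚ_[ℓ]) ⊗[ℚ_[ℓ]] C.etaleH1 ℓ K)), S = Set.range fun g : C.G => op (T.heckeEnd hD K g) := ⟨_, rfl⟩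
  have hSgen' : (Set.range fun g : C.G => ((rationalTateAction (C.A K) ℓ (T.heckeEnd hD K g)).dualMap).baseChange (AlgebraicClosure ℚ_[ℓ])) = Sgen := by
    rw [hSgen, hop]
  obtain ⟨N₀, hN₀⟩ : ∃ N₀ : Submodule (AlgebraicClosure ℚ_[ℓ]) ((AlgebraicClosure ℚ_[ℓ]) ⊗[ℚ_[ℓ]] C.etaleH1 ℓ K),
      N₀ = ((ρW.fixedPoints (K.1.1 : Subgroup C.G)).map f).comap ((C.toTower ℓ K).baseChange (AlgebraicClosure ℚ_[ℓ])) := ⟨_, rfl⟩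
  -- `N₀` is stable under the algebra `ℚ̄_ℓ[Sgen]`
  have hN₀_gen : ∀ (g : C.G), ∀ x ∈ N₀, op (T.heckeEnd hD K g) x ∈ N₀ := by
    intro g x hx
    rw [hN₀] at hx ⊢
    rw [hop']
    exact T.baseChange_dualMap_rationalTateAction_heckeEnd_mem_comap_map K X hX ι ρW hf hD g hx
  have hN₀_adj : ∀ r ∈ Algebra.adjoin (AlgebraicClosure ℚ_[ℓ]) Sgen, ∀ x ∈ N₀, r x ∈ N₀ := by
    intro r hr
    induction hr using Algebra.adjoin_induction with
    | mem s hs =>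
      rw [hSgen] at hs
      obtain ⟨g, rfl⟩ := hs
      exact hN₀_gen g
    | algebraMap a => intro x hx; simpa using N₀.smul_mem a hx
    | add r₁ r₂ _ _ h₁ h₂ => intro x hx; rw [LinearMap.add_apply]; exact N₀.add_mem (h₁ x hx) (h₂ x hx)
    | mul r₁ r₂ _ _ h₁ h₂ => intro x hx; rw [Module.End.mul_apply]; exact h₁ _ (h₂ x hx)
  let N : Submodule (Algebra.adjoin (AlgebraicClosure ℚ_[ℓ]) Sgen) ((AlgebraicClosure ℚ_[ℓ]) ⊗[ℚ_[ℓ]] C.etaleH1 ℓ K) :=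
    { carrier := N₀
      add_mem' := fun ha hb => N₀.add_mem ha hb
      zero_mem' := N₀.zero_mem
      smul_mem' := fun r x hx => hN₀_adj r.1 r.2 x hx }
  have hmemN : ∀ x, x ∈ N ↔ x ∈ N₀ := fun _ => Iff.rfl
  have hcoeN : (N : Set ((AlgebraicClosure ℚ_[ℓ]) ⊗[ℚ_[ℓ]] C.etaleH1 ℓ K)) = N₀ := rfl
  -- `N ≠ 0`
  have hN0 : N ≠ ⊥ := by
    obtain ⟨w, hw, hfw⟩ := hf0
    obtain ⟨x, hx⟩ := hfK w hw
    intro hbot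
    have hxN : x ∈ N := by
      rw [hmemN, hN₀, Submodule.mem_comap, hx]
      exact Submodule.mem_map.2 ⟨w, hw, rfl⟩
    rw [hbot, Submodule.mem_bot] at hxN
    apply hfw
    rw [← hx, hxN, map_zero]
  -- `N` is a simple `ℚ̄_ℓ[Sgen]`-module
  have hN : ∀ U : Submodule (AlgebraicClosure ℚ_[ℓ]) ((AlgebraicClosure ℚ_[ℓ]) ⊗[ℚ_[ℓ]] C.etaleH1 ℓ K), (U : Set ((AlgebraicClosure ℚ_[ℓ]) ⊗[ℚ_[ℓ]] C.etaleH1 ℓ K)) ⊆ N → (∀ s ∈ Sgen, ∀ u ∈ U, s u ∈ U) → U = ⊥ ∨ (U : Set ((AlgebraicClosure ℚ_[ℓ]) ⊗[ℚ_[ℓ]] C.etaleH1 ℓ K)) = N := by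
    intro U hU hUS
    rw [hcoeN, hN₀] at hU ⊢
    rw [← hSgen'] at hUS
    exact T.eq_bot_or_coe_eq_of_forall_heckeEnd_stable K hI X hX ι ρW hf hD U hU hUS
  haveI hsimple := Literature.RingTheory.SimpleModule.isSimpleModule_of_forall_stable Sgen N hN0 hN
  -- the blocks realised in `ℚ̄_ℓ[Sgen]` (operator form: pairwise orthogonal, summing to `1` on `M`, central)
  have hmem : ∀ i, op (c i) ∈ Algebra.adjoin (AlgebraicClosure ℚ_[ℓ]) Sgen := fun i => by
    rw [← hSgen', hop']
    exact T.baseChange_dualMap_rationalTateAction_mem_adjoin ℓ K hD (hcT i)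
  let c' : I → Algebra.adjoin (AlgebraicClosure ℚ_[ℓ]) Sgen := fun i => ⟨op (c i), hmem i⟩
  have hortho' : ∀ i i', i ≠ i' → c' i * c' i' = 0 := fun i i' hii' => by
    apply Subtype.ext
    show op (c i) * op (c i') = 0
    rw [← op_mul, hco.ortho (Ne.symm hii'), op_zero]
  have hsum' : ∀ m : ((AlgebraicClosure ℚ_[ℓ]) ⊗[ℚ_[ℓ]] C.etaleH1 ℓ K), ∑ i, c' i • m = m := fun m => by
    show ∑ i, op (c i) m = m
    rw [← LinearMap.sum_apply, ← op_sum, hco.complete, op_one, Module.End.one_apply]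
  have hz' : ∀ (i : I) (r : Algebra.adjoin (AlgebraicClosure ℚ_[ℓ]) Sgen), c' i * r = r * c' i := by
    intro i r
    apply Subtype.ext
    show op (c i) * (r : Module.End (AlgebraicClosure ℚ_[ℓ]) ((AlgebraicClosure ℚ_[ℓ]) ⊗[ℚ_[ℓ]] C.etaleH1 ℓ K)) = r * op (c i)
    obtain ⟨r, hr⟩ := r
    simp only
    induction hr using Algebra.adjoin_induction with
    | mem s hs =>
      rw [hSgen] at hs
      obtain ⟨g, rfl⟩ := hs
      rw [← op_mul, ← op_mul, hz i _ (T.heckeEnd_mem_heckeImage hD K g)]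
    | algebraMap a => rw [Algebra.commutes]
    | add r₁ r₂ _ _ h₁ h₂ => rw [mul_add, add_mul, h₁, h₂]
    | mul r₁ r₂ _ _ h₁ h₂ => rw [← mul_assoc, h₁, mul_assoc, h₂, mul_assoc]
  -- Lam (22.1), operator form, on the simple module `N`
  obtain ⟨i₀, hi₀, huniq⟩ :=
    Literature.RingTheory.Idempotents.existsUnique_forall_smul_eq_self_of_sum_smul (R := Algebra.adjoin (AlgebraicClosure ℚ_[ℓ]) Sgen) N hortho' hsum' hz'
  -- translate (`c' i • x = op (c i) x`; `op` unfolded by `hop'`)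
  refine ⟨i₀, fun w hw x hx => ?_, fun i hi => huniq i fun n hn => ?_⟩
  · have hxN : x ∈ N := by
      rw [hmemN, hN₀, Submodule.mem_comap, hx]
      exact Submodule.mem_map.2 ⟨w, hw, rfl⟩
    have h1 : op (c i₀) x = x := hi₀ x hxN
    rw [hop'] at h1
    rw [h1, hx]
  · have hn' : (C.toTower ℓ K).baseChange (AlgebraicClosure ℚ_[ℓ]) n ∈ (ρW.fixedPoints (K.1.1 : Subgroup C.G)).map f := by
      have := (hmemN n).1 hn
      rw [hN₀, Submodule.mem_comap] at this
      exact this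
    obtain ⟨w, hw, hwn⟩ := Submodule.mem_map.1 hn'
    have h1 := hi w hw n hwn.symm
    have h4 := LinearMap.congr_fun (hop' (c i)) n
    rw [← h4, hwn] at h1
    -- `h1 : [op (c i) n]_K = [n]_K`
    change op (c i) n = n
    exact toTower_baseChange_injective C ℓ (C.toTower_injective ℓ hI K) h1

/-! ## §4 The values of `f′` on `ω^K` are level-`K` classes (discharge of `hfK`) -/

include hI hX hf in
/-- **`f′(ω^K) ⊆ ℚ̄_ℓ ⊗ [H¹_ét(A_K)]_K`**: for `w ∈ ω^K` the value `f′ w` is fixed by every `rhoEt(k) ⊗ 1`, `k ∈ K` (★ `baseChange_rhoEt_apply_eq_self`),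
the `K`-invariants of the tower are the level-`K` classes (★ `range_toTower_eq_of_isogenyDescent`), and the formation of invariants commutes with the
base change `ℚ̄_ℓ/ℚ_ℓ` (★ `FixedPointsBaseChange`, [Milne2017] Cor. 4.34). [cite: Liu2021, Thm. 4.18 (1) (FJcycle.tex l. 2239) and §4.2 (l. 2158–2166)]
[cite: Milne2017, Cor. 4.34] -/
theorem apply_mem_range_toTower_baseChange (hD : T.IsogenyDescent) {w : W} (hw : w ∈ ρW.fixedPoints (K.1.1 : Subgroup C.G)) :
    f w ∈ LinearMap.range ((C.toTower ℓ K).baseChange (AlgebraicClosure ℚ_[ℓ])) := by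
  -- fixed by `rhoEt k ⊗ 1`, in `lTensor` form
  have hfix : ∀ k : (K.1.1 : Subgroup C.G), ((T.etHeckeRep ℓ (k : C.G) : C.etaleH1Tower ℓ →ₗ[ℚ_[ℓ]] C.etaleH1Tower ℓ)).lTensor (AlgebraicClosure ℚ_[ℓ]) (f w) = f w := by
    intro k
    have h := Sec42Data.EtaleHeckeDatum.baseChange_rhoEt_apply_eq_self X ι ρW hf _ k.2 hw
    rw [hX] at h
    exact (congrFun ((T.etHeckeRep ℓ (k : C.G) : C.etaleH1Tower ℓ →ₗ[ℚ_[ℓ]] C.etaleH1Tower ℓ).baseChange_eq_ltensor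
      (A := (AlgebraicClosure ℚ_[ℓ]))) (f w)).symm.trans h
  -- the common fixed vectors are the level-`K` classes
  have hP : ∀ x : C.etaleH1Tower ℓ, (∀ k : (K.1.1 : Subgroup C.G), (T.etHeckeRep ℓ (k : C.G) : C.etaleH1Tower ℓ →ₗ[ℚ_[ℓ]] C.etaleH1Tower ℓ) x = x) →
      x ∈ LinearMap.range (C.toTower ℓ K) := by
    intro x hx
    have hx' : x ∈ Set.range (C.toTower ℓ K) := by
      rw [T.range_toTower_eq_of_isogenyDescent ℓ hI hD K]
      exact fun k hk => hx ⟨k, hk⟩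
    obtain ⟨y, hy⟩ := hx'
    exact ⟨y, hy⟩
  have hmem := Literature.LinearAlgebra.BaseChange.mem_range_lTensor_subtype_of_lTensor_fixed (A := (AlgebraicClosure ℚ_[ℓ]))
    (fun k : (K.1.1 : Subgroup C.G) => (T.etHeckeRep ℓ (k : C.G) : C.etaleH1Tower ℓ →ₗ[ℚ_[ℓ]] C.etaleH1Tower ℓ))
    (LinearMap.range (C.toTower ℓ K)) hP hfix
  -- `range (subtype.lTensor) = range (toTower.baseChange)`
  obtain ⟨z, hz⟩ := hmem
  obtain ⟨y, rfl⟩ := (LinearMap.lTensor_surjective (AlgebraicClosure ℚ_[ℓ]) (LinearMap.surjective_rangeRestrict (C.toTower ℓ K))) z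
  refine ⟨y, ?_⟩
  have hcomp : (LinearMap.range (C.toTower ℓ K)).subtype ∘ₗ (C.toTower ℓ K).rangeRestrict = C.toTower ℓ K := LinearMap.ext fun _ => rfl
  rw [← hz, ← LinearMap.comp_apply, ← LinearMap.lTensor_comp, hcomp]
  exact congrFun ((C.toTower ℓ K).baseChange_eq_ltensor (A := AlgebraicClosure ℚ_[ℓ])) y


include hI hX hf in
/-- **THE BLOCK OF AN IRREDUCIBLE CONSTITUENT** (final form, `hfK` discharged by `apply_mem_range_toTower_baseChange`): for irreducible `ω`, `f′ ∈
Hom_𝔾(ι_ℓ ∘ ω, ℚ̄_ℓ ⊗ H¹_ét(A_∞))` non-zero on `ω^K`, and blocks `c_i` of `heckeImage K`, exactly one `c_i` acts as the identity on the level-`K`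
classes under `f′(ω^K)`. [cite: Liu2021, p. 133 (D.3) and p. 140 (proof of Thm. D.6 (1), FJcycle.tex l. 5626)] [cite: Bump1997, §4.2 Prop. 4.2.3]
[cite: Lam2001FirstCourse, §22 Prop. (22.1), p. 327] -/
theorem existsUnique_block_baseChange_toTower_eq' (hD : T.IsogenyDescent) [ρW.IsIrreducible]
    (hf0 : ∃ w ∈ ρW.fixedPoints (K.1.1 : Subgroup C.G), f w ≠ 0)
    {I : Type*} [Fintype I] {c : I → (C.A K).endAlgebra} (hcT : ∀ i, c i ∈ T.heckeImage hD K) (hco : CompleteOrthogonalIdempotents c)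
    (hz : ∀ i, ∀ x ∈ T.heckeImage hD K, x * c i = c i * x) :
    ∃! i, ∀ w ∈ ρW.fixedPoints (K.1.1 : Subgroup C.G), ∀ x : ((AlgebraicClosure ℚ_[ℓ]) ⊗[ℚ_[ℓ]] C.etaleH1 ℓ K),
      (C.toTower ℓ K).baseChange (AlgebraicClosure ℚ_[ℓ]) x = f w →
        (C.toTower ℓ K).baseChange (AlgebraicClosure ℚ_[ℓ]) (((rationalTateAction (C.A K) ℓ (c i)).dualMap).baseChange (AlgebraicClosure ℚ_[ℓ]) x) = f w :=
  T.existsUnique_block_baseChange_toTower_eq K hI X hX ι ρW hf hD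
    (fun _ hw => T.apply_mem_range_toTower_baseChange K hI X hX ι ρW hf hD hw) hf0 hcT hco hz

end Selector

end Sec42Data.HeckeTranslates

end Literature.NumberTheory.Automorphic.Liu2021.AppendixC

end
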